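/-
Copyright (c) 2026 the pub-hodgecm-mathlib formalisation cell (harness21).  Prover seat hodgecm-mathlib-R90-C10-p08 (g3), R90-TF SLAB section S1 «Ch10-local» (base
R90-C10), h413 = `stmt-HodgeConjecture-24833`; line «U4Keys :182 — THE WILD CORNER (S-W-Rb)», brick (W-2f) «THE ADDITIVITY WINDOW» = the `hadd` letter of ★ p865411 (W-2d)
`R90S1WildGaussSquareModLetters.gauss_sq_eq_wild` discharged from the organ's conductor letter `hcond` in the regime `n ≤ 2m` (P-WILD-1 v2 ae6d6510 §3 (Y) «additive regime»;
cross-read `P-WILD-1.xread.v1.md` 2e58408c §A.2 ∕ §C).  2026-09-05.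
-/
import Literature.NumberTheory.LocalFields.WildQuadraticDatumTrace                            -- ★ `WildQuadraticDatum.v_varpi_pow`
import Summits.HodgeConjecture.HodgeConjecture.Theorems.R90S1BposRamSkewSphereByFixedUnits   -- ★ PART 1 (R90-C10-p04 (g2)): §2 place-free `Ē`-algebra `diteInv_units_mul`, `diteInv_one_add_eq_one_of_le`; brings ★ `BposRamFixedUnitsHaar` (`isUnit_of_valued_eq_one`, `mul_inv_cancel_of_valued_eq_one`)
import HarnessLib

/-!
# R90-TF S1 «Ch10-local» ∕ U4Keys :182, THE WILD CORNER — brick (W-2f): THE ADDITIVITY WINDOW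
# `Ē(1 + u·c)·Ē(1 + u·c·e) = Ē(1 + u·(1+e)·c)` for units `c, e` of modulus one, whenever `|u_w| ≤ |ϖ|^m` and `χ₁` is trivial at level `n ≤ 2m`

Cell `pub/hodgecm-mathlib`, crux H413 = `stmt-HodgeConjecture-24833`, route of record `HCCMUnconditional` (no route verbs); lane `--supports stmt-HodgeConjecture-24833 --as helper`,
count-neutral.  THEOREMS ONLY (no `def`, no `instance`, no `notation`, no named-fact hypothesis, no `sorry`); ★-only imports.  NOT THE PAYER of :182 ∕ (S-W).

THE MATHEMATICS (P-WILD-1 v2 §3 (Y), the «additive regime `2m ≥ n`»; tame: P-ram-1 (P1) at the live level `m = n − 1`).  `R = LocalRing L v` at a non-split `w ∣ v`, `Ē r := χ₁(r̂)⁻¹`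
on units and `0` off units (the (G·) files' integrand), `u ∈ R` with `|u_w| ≤ |ϖ|^m`, `m ≥ 1`, and the organ's conductor letter `hcond` at level `n`: `χ₁ U = 1` whenever
`|U_{w′} − 1| ≤ |ϖ|^n`.  For `c, e ∈ R` of modulus one put `A = 1 + uc`, `B = 1 + uce`, `D = 1 + u(1+e)c`: then `A·B = D + u²c²e = D·(1 + ε)`, `ε := u²c²e·D⁻¹`, with
`|ε_w| ≤ |ϖ|^{2m} ≤ |ϖ|^n`, so `Ē(1 + ε) = 1` (★ `diteInv_one_add_eq_one_of_le`) and `Ē(A)·Ē(B) = Ē(A·B) = Ē(D)·Ē(1+ε) = Ē(D)` (★ `diteInv_units_mul`).  No fixedness of `c, e`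
and no skewness of `u` is used: the identity holds at EVERY place; the WINDOW `n ≤ 2m` is exactly where `c ↦ Ē(1 + u·c)` is an additive character of `𝒪⁺` (in the non-additive band
`2m < n` the letter is FALSE and (W-2d) must not be instantiated — P-WILD-1 v2 §3, open band).
* **`hadd_of_cond`** — the letter `hadd` of ★ `gauss_sq_eq_wild` with its binders BYTE FOR BYTE (`∀ c e, σc = c → |c_w| = 1 → σe = e → |e_w| = 1 → …`; the two fixedness hypotheses
  are carried unused so that the theorem IS the letter, positionally).
HONEST LABEL.  HC_CM is proved only modulo the 7 printed citations (2 remaining named inputs: hLiu418 = `stmt-HodgeConjecture-24832`, h413 = `stmt-HodgeConjecture-24833`) until rung 0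
closes; (W-2f) is infrastructure of the (S-W-Rb) additive regime and pays NO socket; (S-W) stays OPEN; REL ≠ ★ ≠ BUILT.

## References
* [Keys1984] D. Keys, *Principal series representations of special unitary groups over local fields*, Compositio Math. 51 (1984), §4–§5 (conductor windows), §7 Theorem (2) (d) p. 126.
* [BushnellHenniart2006] C. J. Bushnell, G. Henniart, *The Local Langlands Conjecture for GL(2)*, Grundlehren 335 (2006), §23.4–23.6 (level of additive characters `c ↦ χ(1 + uc)`).
* [Serre1979] J.-P. Serre, *Local Fields*, GTM 67 (1979), Ch. XV §2.
-/

set_option autoImplicit false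
-- the mandated namespace has the single-problem summit's repeated segment (`HodgeConjecture.HodgeConjecture`)
set_option linter.dupNamespace false

noncomputable section

open NumberField IsDedekindDomain
open scoped Valued
open Literature.NumberTheory.Automorphic Literature.NumberTheory.Automorphic.UnitaryGroup
open Literature.NumberTheory.LocalFields
open Summit.HodgeConjecture.HodgeConjecture.Cruxes.H413
open Summit.HodgeConjecture.HodgeConjecture.R90.S1.BposRamFixedUnitsHaar
open Summit.HodgeConjecture.HodgeConjecture.R90.S1.BposRamSkewSphereByFixedUnits

namespace Summit.HodgeConjecture.HodgeConjecture.R90.S1.WildAdditivityWindow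

variable (L : Type) [Field L] [NumberField L] [IsCMField L] (v : HeightOneSpectrum (𝓞 ↥(maximalRealSubfield L)))
  (w : PlacesOver L v) (hw : IsCMField.complexConj L • w.1 = w.1)

omit [IsCMField L] in
/-- In `ℤᵐ⁰`: `|ϖ|^a ≤ |ϖ|^b` for `b ≤ a`, and `|ϖ|^m < 1` for `m ≥ 1`. [cite: Serre1979, Ch. II §1] -/
private theorem varpi_pow_le_and_lt {ϖ : w.1.adicCompletion L} (hϖ : Valued.v ϖ = WithZero.exp (-1 : ℤ)) {a b m : ℕ} (h : b ≤ a) (hm : 1 ≤ m) :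
    Valued.v ϖ ^ a ≤ Valued.v ϖ ^ b ∧ Valued.v ϖ ^ m < 1 := by
  refine ⟨?_, ?_⟩
  · rw [WildQuadraticDatum.v_varpi_pow hϖ a, WildQuadraticDatum.v_varpi_pow hϖ b, WithZero.exp_le_exp]; omega
  · rw [WildQuadraticDatum.v_varpi_pow hϖ m, ← WithZero.exp_zero, WithZero.exp_lt_exp]; omega

open scoped Classical in
include hw in
/-- **THE ADDITIVITY WINDOW — the `hadd` letter of ★ `gauss_sq_eq_wild`**: for `χ₁` trivial at level `n` (`hcond`), `|u_w| ≤ |ϖ|^m` with `1 ≤ m` and `n ≤ 2m`, and ALL `c, e ∈ R`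
of modulus one at `w`: `Ē(1 + uc)·Ē(1 + u(ce)) = Ē(1 + u(1+e)c)` — `(1+uc)(1+uce) = (1 + u(1+e)c)·(1 + ε)`, `|ε_w| ≤ |ϖ|^{2m} ≤ |ϖ|^n`.  The binders are those of the letter (the two
`σ`-fixedness hypotheses are carried unused). [cite: Keys1984, §4–§5] [cite: BushnellHenniart2006, §23.4–23.6] -/
theorem hadd_of_cond (χ₁ : (LocalRing L v)ˣ →* ℂˣ) {ϖ : w.1.adicCompletion L} (hϖ : Valued.v ϖ = WithZero.exp (-1 : ℤ)) {n m : ℕ} (hm1 : 1 ≤ m) (hnm : n ≤ 2 * m)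
    (hcond : ∀ U : (LocalRing L v)ˣ, (∀ w' : PlacesOver L v, Valued.v (((U : LocalRing L v) w') - 1) ≤ Valued.v ϖ ^ n) → χ₁ U = 1)
    {u : LocalRing L v} (hum : Valued.v (u w) ≤ Valued.v ϖ ^ m) :
    ∀ c e : LocalRing L v, conjLocal L (IsCMField.complexConj L) v c = c → Valued.v (c w) = 1 →
      conjLocal L (IsCMField.complexConj L) v e = e → Valued.v (e w) = 1 →
      (fun r : LocalRing L v => if h : IsUnit r then (((χ₁ h.unit)⁻¹ : ℂˣ) : ℂ) else 0) (1 + u * c) *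
          (fun r : LocalRing L v => if h : IsUnit r then (((χ₁ h.unit)⁻¹ : ℂˣ) : ℂ) else 0) (1 + u * (c * e)) =
        (fun r : LocalRing L v => if h : IsUnit r then (((χ₁ h.unit)⁻¹ : ℂˣ) : ℂ) else 0) (1 + u * (1 + e) * c) := by
  haveI : Algebra.IsQuadraticExtension ↥(maximalRealSubfield L) L := IsCMField.isQuadraticExtension L
  haveI : Subsingleton (PlacesOver L v) :=
    PlacesOver.subsingleton_of_smul_eq (IsCMField.complexConj L) (IsCMField.complexConj_ne_one L) w hw
  intro c e _hσc hc _hσe he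
  obtain ⟨h2m, hm⟩ := varpi_pow_le_and_lt L v w hϖ hnm hm1
  have hu1 : Valued.v (u w) < 1 := lt_of_le_of_lt hum hm
  -- moduli: `uc`, `uce`, `u(1+e)c` are small, so `A, B, D` have modulus one
  have he1 : Valued.v ((1 + e) w) ≤ 1 := by
    rw [Pi.add_apply, Pi.one_apply]; exact (Valuation.map_add _ _ _).trans (by rw [map_one, he, max_self])
  have hvuc : Valued.v ((u * c) w) ≤ Valued.v ϖ ^ m := by rw [Pi.mul_apply, map_mul, hc, mul_one]; exact hum
  have hvuce : Valued.v ((u * (c * e)) w) ≤ Valued.v ϖ ^ m := by rw [Pi.mul_apply, map_mul, Pi.mul_apply, map_mul, hc, he, mul_one, mul_one]; exact hum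
  have hvD' : Valued.v ((u * (1 + e) * c) w) ≤ Valued.v ϖ ^ m := by
    rw [Pi.mul_apply, Pi.mul_apply, map_mul, map_mul, hc, mul_one]
    exact (mul_le_of_le_one_right' he1).trans hum
  have hone : ∀ {t : LocalRing L v}, Valued.v (t w) ≤ Valued.v ϖ ^ m → Valued.v ((1 + t) w) = 1 := fun ht => by
    rw [Pi.add_apply, Pi.one_apply]; exact Valuation.map_one_add_of_lt _ (lt_of_le_of_lt ht hm)
  have hA1 : Valued.v ((1 + u * c) w) = 1 := hone hvuc
  have hD1 : Valued.v ((1 + u * (1 + e) * c) w) = 1 := hone hvD'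
  have hAU := isUnit_of_valued_eq_one L v w hw hA1
  have hDU := isUnit_of_valued_eq_one L v w hw hD1
  -- `ε := u²c²e·D⁻¹`, `|ε_w| ≤ |ϖ|^{2m} ≤ |ϖ|^n`
  set D : LocalRing L v := 1 + u * (1 + e) * c with hDdef
  set ε : LocalRing L v := u * u * (c * c) * e * D⁻¹ with hεdef
  have hDinv : Valued.v (D⁻¹ w) = 1 := valued_inv_apply_of_valued_eq_one L v w hD1
  have hvε : Valued.v (ε w) ≤ Valued.v ϖ ^ (2 * m) := by
    have e1 : Valued.v (ε w) = Valued.v (u w) * Valued.v (u w) := by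
      rw [hεdef]; simp only [Pi.mul_apply, map_mul, hc, he, hDinv, mul_one]
    rw [e1]
    calc Valued.v (u w) * Valued.v (u w) ≤ Valued.v ϖ ^ m * Valued.v ϖ ^ m := mul_le_mul' hum hum
      _ = Valued.v ϖ ^ (2 * m) := by rw [← pow_add, two_mul]
  have h2m1 : Valued.v ϖ ^ (2 * m) < 1 := (varpi_pow_le_and_lt L v w hϖ (le_refl n) (show 1 ≤ 2 * m by omega)).2
  -- `χ₁` is trivial at level `2m` (`|ϖ|^{2m} ≤ |ϖ|^n`)
  have htriv : ∀ U : (LocalRing L v)ˣ, Valued.v (((U : LocalRing L v) - 1) w) ≤ Valued.v ϖ ^ (2 * m) → χ₁ U = 1 := by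
    intro U hU
    refine hcond U fun w' => ?_
    obtain rfl : w' = w := Subsingleton.elim _ _
    rw [Pi.sub_apply, Pi.one_apply] at hU
    exact hU.trans h2m
  -- `A·B = D·(1 + ε)`
  have hDD : D * D⁻¹ = 1 := mul_inv_cancel_of_valued_eq_one L v w hw hD1
  have hfac : (1 + u * c) * (1 + u * (c * e)) = D * (1 + ε) := by
    have h1 : (1 + u * c) * (1 + u * (c * e)) = D + u * u * (c * c) * e := by rw [hDdef]; ring
    rw [h1, mul_add, mul_one, hεdef, show D * (u * u * (c * c) * e * D⁻¹) = u * u * (c * c) * e * (D * D⁻¹) by ring, hDD, mul_one]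
  -- `Ē(A)Ē(B) = Ē(A·B) = Ē(D)·Ē(1+ε) = Ē(D)`
  have hmulA := diteInv_units_mul L v χ₁ hAU.unit (1 + u * (c * e))
  rw [IsUnit.unit_spec] at hmulA
  have hEA : (fun r : LocalRing L v => if h : IsUnit r then (((χ₁ h.unit)⁻¹ : ℂˣ) : ℂ) else 0) (1 + u * c) = (((χ₁ hAU.unit)⁻¹ : ℂˣ) : ℂ) := by
    have h := diteInv_units L v χ₁ hAU.unit
    rwa [IsUnit.unit_spec] at h
  have hmulD := diteInv_units_mul L v χ₁ hDU.unit (1 + ε)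
  rw [IsUnit.unit_spec] at hmulD
  have hED : (fun r : LocalRing L v => if h : IsUnit r then (((χ₁ h.unit)⁻¹ : ℂˣ) : ℂ) else 0) D = (((χ₁ hDU.unit)⁻¹ : ℂˣ) : ℂ) := by
    have h := diteInv_units L v χ₁ hDU.unit
    rwa [IsUnit.unit_spec] at h
  have hε1 : (fun r : LocalRing L v => if h : IsUnit r then (((χ₁ h.unit)⁻¹ : ℂˣ) : ℂ) else 0) (1 + ε) = 1 :=
    diteInv_one_add_eq_one_of_le L v w hw χ₁ h2m1 htriv hvε
  rw [hEA, ← hmulA, hfac, hmulD, hε1, mul_one, ← hED]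

end Summit.HodgeConjecture.HodgeConjecture.R90.S1.WildAdditivityWindow

end
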